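import Literature.Algebra.Polynomial.CasasAlvero.CharFiveHundredFiftySevenPartial
import Literature.Algebra.Polynomial.CasasAlvero.Degree8Char557
import HarnessLib

/-!
# Casas-Alvero degrees in characteristic 557: the complete classification

`classification_char_fiveHundredFiftySeven_complete`: over every field `K` of characteristic `557`,
`CA_d ⟺ d = 0 ∨ d = a·557^k` with `1 ≤ a ≤ 8`.  This is `classification_char_fiveHundredFiftySeven_of_degree_eight`
(`CharFiveHundredFiftySevenPartial.lean`: digits `≤ 7` except as noted, every digit `9 ≤ a < 557` bad, digit `8` conditional) with its hypothesis
`∀ k, HoldsInDegree K (8·557^k)` DISCHARGED by the kernel-checked degree-`8` scenario certificates (`Degree8Char557.lean`,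
`holdsInDegree_eight_mul_pow_of_char_557`).  `557` is good for degree `7` (`Degree7Char557.lean`) and GOOD for degree `8`; `419` is the least prime that is good for degree `8`
while bad for degree `7`.  [cite: GrafVonBothmerEtAl2007, Props. 2, 6, 7] [cite: CastryckLaterveerOunaies2012, Thm. 4]  No `sorry`, no new axioms.
-/

set_option linter.style.longLine false

noncomputable section

open Polynomial

namespace Literature.Algebra.Polynomial.CasasAlvero

variable (K : Type*) [Field K] [CharP K 557]

/-- **characteristic 557, complete**: over every field of characteristic `557`, `CA_d ⟺ d = 0 ∨ d = a·557^k` with `1 ≤ a ≤ 8`.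
[cite: GrafVonBothmerEtAl2007, Props. 2, 6, 7] [cite: CastryckLaterveerOunaies2012, Thm. 4] -/
theorem classification_char_fiveHundredFiftySeven_complete (d : ℕ) :
    HoldsInDegree K d ↔ d = 0 ∨ ∃ k a : ℕ, 0 < a ∧ a ≤ 8 ∧ d = a * 557 ^ k :=
  classification_char_fiveHundredFiftySeven_of_degree_eight K (holdsInDegree_eight_mul_pow_of_char_557 (K := K)) d

end Literature.Algebra.Polynomial.CasasAlvero
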